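import Literature.Topology.FourManifolds.NormalPositionGeometry
import Literature.Topology.FourManifolds.BandSum
import Mathlib.LinearAlgebra.CrossProduct
import HarnessLib

/-!
# The crossing frame of a band in normal position

Topic `Literature/Topology/FourManifolds` (trunk T-4MAN). Infrastructure for the fact seat
`provefact-Literature.Topology.FourManifolds.Knot.IsConnectedSum.isIsotopic` (Schubert's theorem;
stage S1 of the proof of the geometric heart for rail knots works at a small scale `κ` around the
point `band (1/2, 1/2)` where the core of the band crosses the separating sphere, in coordinates in
which the band is flat to first order). Everything here is proved; no named facts are introduced.

For `b : BandData A B K avoid` read in the stereographic chart `ψ` from the north pole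
(`NormalPositionGeometry.lean`):

* `b.crossPt = band (1/2, 1/2)` and `b.Fband q = ψ (band ((1/2, 1/2) + q))`, the band near the
  crossing point read in the chart; `b.pZero = Fband 0`. In normal position (`A` north, `B` south,
  the band meeting the equator exactly in its middle line) `Fband` is `C^∞` near `0`
  (`contDiffAt_Fband`), `‖pZero‖ = 2` (`norm_pZero`), `‖Fband (0, v)‖ = 2` and `‖Fband (a, v)‖ < 2`
  for `a > 0` (small arguments).
* `b.fZero`, `b.fOne` — the images of the two coordinate directions under `D Fband (0)`; they are
  linearly independent (`linearIndependent_fZero_fOne`: the band is an immersion and the chart has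
  invertible differential), `⟪pZero, fOne⟫ = 0` (`inner_pZero_fOne`: the middle line stays on the
  sphere of radius `2`) and `⟪pZero, fZero⟫ ≤ 0` (`inner_pZero_fZero_nonpos`: to the right of the
  middle line the band is inside the ball).
* `b.gTwo = fZero × fOne` and the **crossing frame** `b.frame : ℝ³ ≃L[ℝ] ℝ³`,
  `Y ↦ Y₀ fZero + Y₁ fOne + Y₂ gTwo`; the **blow-up coordinates** `b.blowUp κ y = κ⁻¹ frame⁻¹ (y - pZero)`.
* **Flatness** (`exists_flat`): for every `ε > 0` there is `r > 0` such that for `‖q‖, ‖q'‖ ≤ r`,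
  `‖frame⁻¹ (Fband q - Fband q') - (q₀ - q'₀, q₁ - q'₁, 0)‖ ≤ ε ‖q - q'‖` (strict differentiability of
  `Fband` at `0`, transported by the frame).

## References

* J. M. Lee, *Introduction to Smooth Manifolds*, 2nd ed. (2012), Ex. 1.4 (stereographic
  coordinates), Prop. 3.23 (differentials in coordinates). [LeeSmoothManifolds2013]
-/

open scoped Manifold ContDiff Topology Real RealInnerProductSpace Matrix
open Function Set Metric Filter

noncomputable section

namespace Literature.Topology.FourManifolds

/-- Local notation: `𝔼 n` is the model Euclidean space `EuclideanSpace ℝ (Fin n)`. -/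
local notation "𝔼 " n:arg => EuclideanSpace ℝ (Fin n)

/-- Local notation: `𝕊 n` is the unit sphere in `EuclideanSpace ℝ (Fin (n + 1))`. -/
local notation "𝕊 " n:arg => (Metric.sphere (0 : EuclideanSpace ℝ (Fin (n + 1))) 1)

attribute [local instance] fact_finrank_euclideanSpace_succ

open KnotsInBall

namespace BandData

variable {A B K : Knot} {avoid : Set (𝕊 3)} (b : BandData A B K avoid)

/-! ### The band near the crossing point, read in the chart -/

/-- **The crossing point** `band (1/2, 1/2)` of the core of the band with the separating sphere.
[folklore] -/
def crossPt : 𝕊 3 := b.band (pt2 2⁻¹ 2⁻¹)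

/-- **The band near the crossing point, read in the chart from the north pole**:
`Fband q = ψ (band ((1/2, 1/2) + q))`. [folklore] -/
def Fband (q : 𝔼 2) : 𝔼 3 := psiN (b.band (pt2 2⁻¹ 2⁻¹ + q))

/-- The crossing point read in the chart. [folklore] -/
def pZero : 𝔼 3 := b.Fband 0

/-- `pZero = ψ crossPt`. [folklore] -/
theorem pZero_eq : b.pZero = psiN b.crossPt := by
  simp [pZero, Fband, crossPt]

/-- The centre `(1/2, 1/2)` of the collar lies in the square neighbourhood. [folklore] -/
theorem centre_mem_squareNhd : pt2 2⁻¹ 2⁻¹ ∈ squareNhd b.δ := by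
  have hδ := b.δ_pos
  rw [mem_squareNhd_iff]
  intro i
  fin_cases i <;> simp <;> constructor <;> linarith

/-- Small translates of the centre lie in the square neighbourhood: `‖q‖ < 1/2` suffices.
[folklore] -/
theorem centre_add_mem_squareNhd {q : 𝔼 2} (hq : ‖q‖ < 2⁻¹) : pt2 2⁻¹ 2⁻¹ + q ∈ squareNhd b.δ := by
  have hδ := b.δ_pos
  have hqi : ∀ i, |q i| < 2⁻¹ := fun i ↦ lt_of_le_of_lt (by
    simpa [Real.norm_eq_abs] using PiLp.norm_apply_le q i) hq
  have h0 := abs_lt.1 (hqi 0)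
  have h1 := abs_lt.1 (hqi 1)
  rw [mem_squareNhd_iff]
  intro i
  fin_cases i <;> simp <;> constructor <;> linarith [h0.1, h0.2, h1.1, h1.2]


/-! ### Normal position: no pole near the crossing point; smoothness of `Fband` -/

section NormalPosition

variable (hA : A.InNorth) (hB : B.InSouth)
  (hcross : b.band ⁻¹' sphereEquator 2 ∩ squareNhd b.δ = {x ∈ squareNhd b.δ | x 0 = 2⁻¹})
include hcross

/-- The crossing point lies on the equator. [folklore] -/
theorem crossPt_last_eq_zero : ((b.crossPt : 𝕊 3) : 𝔼 4) (Fin.last 3) = 0 :=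
  b.band_last_eq_zero_of_eq_half hcross b.centre_mem_squareNhd (by simp)

/-- **Near the crossing point the band stays away from the north pole**: there is `r > 0` such that
`band ((1/2, 1/2) + q) ≠ northPole` for `‖q‖ < r` (the last coordinate is continuous and vanishes
at the crossing point). [folklore] -/
theorem exists_band_ne_northPole : ∃ r > 0, r ≤ 2⁻¹ ∧ ∀ q : 𝔼 2, ‖q‖ < r → b.band (pt2 2⁻¹ 2⁻¹ + q) ≠ northPole := by
  have hc : ContinuousAt (fun q : 𝔼 2 ↦ ((b.band (pt2 2⁻¹ 2⁻¹ + q) : 𝕊 3) : 𝔼 4) (Fin.last 3)) 0 :=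
    (b.continuous_band_last.comp (continuous_const.add continuous_id)).continuousAt
  have h0 : ((b.band (pt2 2⁻¹ 2⁻¹ + 0) : 𝕊 3) : 𝔼 4) (Fin.last 3) < 1 := by
    rw [add_zero]; have := b.crossPt_last_eq_zero hcross; rw [crossPt] at this; rw [this]; norm_num
  have hev := hc.eventually (Iio_mem_nhds h0)
  obtain ⟨r, hr, hball⟩ := Metric.eventually_nhds_iff.1 hev
  refine ⟨min r 2⁻¹, lt_min hr (by norm_num), min_le_right _ _, fun q hq ↦ ?_⟩
  have hq' : dist q 0 < r := by rw [dist_zero_right]; exact lt_of_lt_of_le hq (min_le_left _ _)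
  exact ne_northPole_of_lt (hball hq')

/-- **The pole-free radius** at the crossing point (chosen). [folklore] -/
def poleRad : ℝ := (b.exists_band_ne_northPole hcross).choose

/-- The pole-free radius is positive and at most `1/2`. [folklore] -/
theorem poleRad_pos : 0 < b.poleRad hcross ∧ b.poleRad hcross ≤ 2⁻¹ :=
  ⟨(b.exists_band_ne_northPole hcross).choose_spec.1, (b.exists_band_ne_northPole hcross).choose_spec.2.1⟩

/-- Within the pole-free radius the band is not the north pole. [folklore] -/
theorem band_ne_northPole_of_norm_lt {q : 𝔼 2} (hq : ‖q‖ < b.poleRad hcross) :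
    b.band (pt2 2⁻¹ 2⁻¹ + q) ≠ northPole :=
  (b.exists_band_ne_northPole hcross).choose_spec.2.2 q hq

/-- **`Fband` is `C^∞` within the pole-free radius** (chart smooth off the pole, band smooth).
[folklore] -/
theorem contDiffAt_Fband {q : 𝔼 2} (hq : ‖q‖ < b.poleRad hcross) : ContDiffAt ℝ ∞ b.Fband q := by
  have h1 : ContMDiffAt 𝓘(ℝ, 𝔼 2) (𝓡 3) ∞ (fun q : 𝔼 2 ↦ b.band (pt2 2⁻¹ 2⁻¹ + q)) q :=
    (b.contMDiff.comp (contDiff_const.add contDiff_id).contMDiff) q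
  have h2 : ContMDiffAt (𝓡 3) 𝓘(ℝ, 𝔼 3) ∞ psiN (b.band (pt2 2⁻¹ 2⁻¹ + q)) :=
    isFullChart_psiN.contMDiffAt (mem_psiN_source (b.band_ne_northPole_of_norm_lt hcross hq))
  have h := h2.comp q h1
  exact contMDiffAt_iff_contDiffAt.1 h

/-- `Fband` is differentiable within the pole-free radius. [folklore] -/
theorem differentiableAt_Fband {q : 𝔼 2} (hq : ‖q‖ < b.poleRad hcross) : DifferentiableAt ℝ b.Fband q :=
  (b.contDiffAt_Fband hcross hq).differentiableAt (by simp)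

/-- `Fband` is `C^∞` at `0`. [folklore] -/
theorem contDiffAt_Fband_zero : ContDiffAt ℝ ∞ b.Fband 0 :=
  b.contDiffAt_Fband hcross (by simpa using (b.poleRad_pos hcross).1)

/-! ### The norm of `Fband`: the middle line on the sphere of radius `2`, the right half inside -/

/-- On the middle line the band read in the chart has norm `2`. [folklore] -/
theorem norm_Fband_of_zero {q : 𝔼 2} (hq : ‖q‖ < 2⁻¹) (hq0 : q 0 = 0) : ‖b.Fband q‖ = 2 := by
  have hmem := b.centre_add_mem_squareNhd hq
  have hhalf : (pt2 2⁻¹ 2⁻¹ + q) 0 = 2⁻¹ := by simp [hq0]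
  have hlast := b.band_last_eq_zero_of_eq_half hcross hmem hhalf
  have hne : b.band (pt2 2⁻¹ 2⁻¹ + q) ≠ northPole := ne_northPole_of_nonpos hlast.le
  have h := norm_psiN_sq_mul hne
  rw [hlast] at h
  have h2 : ‖psiN (b.band (pt2 2⁻¹ 2⁻¹ + q))‖ ^ 2 = 2 ^ 2 := by nlinarith
  have h3 := (pow_left_inj₀ (norm_nonneg _) (by norm_num : (0:ℝ) ≤ 2) two_ne_zero).1 h2
  exact h3

/-- `‖pZero‖ = 2`. [folklore] -/
theorem norm_pZero : ‖b.pZero‖ = 2 :=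
  b.norm_Fband_of_zero hcross (q := 0) (by norm_num) rfl

include hB in
/-- Right of the middle line the band read in the chart has norm `< 2`. [folklore] -/
theorem norm_Fband_lt_two {q : 𝔼 2} (hq : ‖q‖ < 2⁻¹) (hq0 : 0 < q 0) : ‖b.Fband q‖ < 2 := by
  have hmem := b.centre_add_mem_squareNhd hq
  have hhalf : 2⁻¹ < (pt2 2⁻¹ 2⁻¹ + q) 0 := by simp; linarith
  have hlast := b.band_last_neg_of_half_lt hB hcross hmem hhalf
  exact (norm_psiN_lt_two_iff (ne_northPole_of_nonpos hlast.le)).2 hlast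

end NormalPosition

/-! ### The differential at the crossing point -/

/-- `(0, 0) = 0` in `ℝ²`. [folklore] -/
theorem pt2_zero_zero : (pt2 0 0 : 𝔼 2) = 0 := by
  ext i; fin_cases i <;> simp

/-- **First frame vector**: the image of the `x₀`-direction under `D Fband (0)`. [folklore] -/
def fZero : 𝔼 3 := fderiv ℝ b.Fband 0 (pt2 1 0)

/-- **Second frame vector**: the image of the height direction under `D Fband (0)`. [folklore] -/
def fOne : 𝔼 3 := fderiv ℝ b.Fband 0 (pt2 0 1)

section Differential

variable (hB : B.InSouth)
  (hcross : b.band ⁻¹' sphereEquator 2 ∩ squareNhd b.δ = {x ∈ squareNhd b.δ | x 0 = 2⁻¹})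
include hcross

/-- **The differential of `Fband` at `0` is injective**: it is the composite of the (invertible)
differential of the chart with the (injective) differential of the band. [folklore] -/
theorem injective_fderiv_Fband_zero : Injective (fderiv ℝ b.Fband 0) := by
  have hn : (∞ : ℕ∞ω) ≠ 0 := by simp
  set τ : 𝔼 2 → 𝔼 2 := fun q ↦ pt2 2⁻¹ 2⁻¹ + q with hτ
  set g : 𝔼 2 → 𝕊 3 := fun q ↦ b.band (τ q) with hg
  have hFg : b.Fband = psiN ∘ g := rfl
  have hτd : MDifferentiableAt 𝓘(ℝ, 𝔼 2) 𝓘(ℝ, 𝔼 2) τ 0 :=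
    ((contDiff_const.add contDiff_id).contMDiff 0).mdifferentiableAt hn
  have hbd : MDifferentiableAt 𝓘(ℝ, 𝔼 2) (𝓡 3) b.band (τ 0) := (b.contMDiff (τ 0)).mdifferentiableAt hn
  have hgd : MDifferentiableAt 𝓘(ℝ, 𝔼 2) (𝓡 3) g 0 := hbd.comp 0 hτd
  have hne : g 0 ≠ northPole := by
    simpa [hg, hτ] using b.band_ne_northPole_of_norm_lt hcross (q := 0) (by simpa using (b.poleRad_pos hcross).1)
  have hψd : MDifferentiableAt (𝓡 3) 𝓘(ℝ, 𝔼 3) psiN (g 0) :=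
    (isFullChart_psiN.contMDiffAt (mem_psiN_source hne)).mdifferentiableAt hn
  -- `fderiv = mfderiv` and the chain rule
  rw [← mfderiv_eq_fderiv, hFg, mfderiv_comp 0 hψd hgd]
  have hg' : mfderiv 𝓘(ℝ, 𝔼 2) (𝓡 3) g 0 = (mfderiv 𝓘(ℝ, 𝔼 2) (𝓡 3) b.band (τ 0)).comp
      (mfderiv 𝓘(ℝ, 𝔼 2) 𝓘(ℝ, 𝔼 2) τ 0) := mfderiv_comp 0 hbd hτd
  have hτ' : mfderiv 𝓘(ℝ, 𝔼 2) 𝓘(ℝ, 𝔼 2) τ 0 = ContinuousLinearMap.id ℝ (𝔼 2) := by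
    rw [mfderiv_eq_fderiv, hτ, fderiv_const_add]
    exact fderiv_id
  rw [hg', hτ']
  obtain ⟨e, he⟩ := (isFullChart_psiN.isInvertible_mfderiv (mem_psiN_source hne)).1
  have h0 : τ 0 = pt2 2⁻¹ 2⁻¹ := by simp [hτ]
  have hbinj : Injective (mfderiv 𝓘(ℝ, 𝔼 2) (𝓡 3) b.band (τ 0)) := by
    rw [h0]; exact b.injective_mfderiv _ b.centre_mem_squareNhd
  have heinj : Injective (mfderiv (𝓡 3) 𝓘(ℝ, 𝔼 3) psiN (g 0)) := by rw [← he]; exact e.injective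
  exact heinj.comp (hbinj.comp injective_id)

/-- **The two frame vectors are linearly independent.** [folklore] -/
theorem linearIndependent_fZero_fOne : LinearIndependent ℝ ![b.fZero, b.fOne] := by
  have hinj := b.injective_fderiv_Fband_zero hcross
  have hli : LinearIndependent ℝ ![pt2 (1 : ℝ) 0, pt2 0 1] := by
    rw [LinearIndependent.pair_iff]
    intro s t hst
    have h0 := congrArg (fun x : 𝔼 2 ↦ x 0) hst
    have h1 := congrArg (fun x : 𝔼 2 ↦ x 1) hst
    simp at h0 h1
    exact ⟨h0, h1⟩
  have h := hli.map' (fderiv ℝ b.Fband 0 : 𝔼 2 →ₗ[ℝ] 𝔼 3) (LinearMap.ker_eq_bot.2 hinj)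
  have e : ⇑(fderiv ℝ b.Fband 0 : 𝔼 2 →ₗ[ℝ] 𝔼 3) ∘ ![pt2 (1 : ℝ) 0, pt2 0 1] = ![b.fZero, b.fOne] := by
    funext i; fin_cases i <;> rfl
  rwa [e] at h

/-- The frame vectors are nonzero. [folklore] -/
theorem fZero_ne_zero : b.fZero ≠ 0 := by
  have h := (b.linearIndependent_fZero_fOne hcross).ne_zero 0
  simpa using h

/-- The frame vectors are nonzero. [folklore] -/
theorem fOne_ne_zero : b.fOne ≠ 0 := by
  have h := (b.linearIndependent_fZero_fOne hcross).ne_zero 1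
  simpa using h

/-- The derivative of `Fband` along the height direction at `0`. [folklore] -/
theorem hasDerivAt_Fband_vertical : HasDerivAt (fun v : ℝ ↦ b.Fband (pt2 0 v)) b.fOne 0 := by
  have hF := (b.differentiableAt_Fband hcross (q := 0) (by simpa using (b.poleRad_pos hcross).1)).hasFDerivAt
  have hc : HasDerivAt (fun v : ℝ ↦ (pt2 0 v : 𝔼 2)) (pt2 0 1) 0 := by
    have e : (fun v : ℝ ↦ (pt2 0 v : 𝔼 2)) = fun v ↦ v • pt2 0 1 := by
      funext v; ext i; fin_cases i <;> simp
    rw [e]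
    simpa using (hasDerivAt_id (0 : ℝ)).smul_const (pt2 (0 : ℝ) 1)
  have h := hF.comp_hasDerivAt_of_eq (0 : ℝ) hc (by rw [pt2_zero_zero])
  exact h

/-- The derivative of `Fband` along the `x₀`-direction at `0`. [folklore] -/
theorem hasDerivAt_Fband_horizontal : HasDerivAt (fun a : ℝ ↦ b.Fband (pt2 a 0)) b.fZero 0 := by
  have hF := (b.differentiableAt_Fband hcross (q := 0) (by simpa using (b.poleRad_pos hcross).1)).hasFDerivAt
  have hc : HasDerivAt (fun a : ℝ ↦ (pt2 a 0 : 𝔼 2)) (pt2 1 0) 0 := by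
    have e : (fun a : ℝ ↦ (pt2 a 0 : 𝔼 2)) = fun a ↦ a • pt2 1 0 := by
      funext a; ext i; fin_cases i <;> simp
    rw [e]
    simpa using (hasDerivAt_id (0 : ℝ)).smul_const (pt2 (1 : ℝ) 0)
  have h := hF.comp_hasDerivAt_of_eq (0 : ℝ) hc (by rw [pt2_zero_zero])
  exact h

/-- **The second frame vector is tangent to the sphere of radius `2`**: `⟪pZero, fOne⟫ = 0` (the
middle line of the band stays on the equatorial sphere, of radius `2` in the chart). [folklore] -/
theorem inner_pZero_fOne : ⟪b.pZero, b.fOne⟫ = 0 := by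
  have hd := (b.hasDerivAt_Fband_vertical hcross).norm_sq
  -- the function is constant `4` near `0`
  have hconst : (fun v : ℝ ↦ ‖b.Fband (pt2 0 v)‖ ^ 2) =ᶠ[𝓝 0] fun _ ↦ 4 := by
    have hwin : Ioo (-(4⁻¹ : ℝ)) 4⁻¹ ∈ 𝓝 (0 : ℝ) := Ioo_mem_nhds (by norm_num) (by norm_num)
    filter_upwards [hwin] with v hv
    have hnorm : ‖(pt2 0 v : 𝔼 2)‖ < 2⁻¹ := by
      rw [EuclideanSpace.norm_eq]
      have : ∑ i : Fin 2, ‖(pt2 0 v : 𝔼 2) i‖ ^ 2 = v ^ 2 := by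
        simp [Fin.sum_univ_two]
      rw [this, Real.sqrt_sq_eq_abs]
      have := abs_lt.2 ⟨hv.1, hv.2⟩
      linarith [abs_nonneg v, (abs_lt.1 this)]
    rw [b.norm_Fband_of_zero hcross hnorm (by simp)]
    norm_num
  have hd' : HasDerivAt (fun v : ℝ ↦ ‖b.Fband (pt2 0 v)‖ ^ 2) 0 0 :=
    (hasDerivAt_const (0 : ℝ) (4 : ℝ)).congr_of_eventuallyEq hconst
  have := hd.unique hd'
  have h0 : b.Fband (pt2 0 0) = b.pZero := by rw [pt2_zero_zero]; rfl
  rw [h0] at this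
  linarith

include hB in
/-- **The first frame vector points weakly into the ball**: `⟪pZero, fZero⟫ ≤ 0` (right of the
middle line the band is inside the ball of radius `2`). [folklore] -/
theorem inner_pZero_fZero_nonpos : ⟪b.pZero, b.fZero⟫ ≤ 0 := by
  have hd := (b.hasDerivAt_Fband_horizontal hcross).norm_sq
  have h0 : b.Fband (pt2 0 0) = b.pZero := by rw [pt2_zero_zero]; rfl
  rw [h0] at hd
  -- slopes from the right are nonpositive
  have hslope : ∀ᶠ a in 𝓝[>] (0 : ℝ), slope (fun a : ℝ ↦ ‖b.Fband (pt2 a 0)‖ ^ 2) 0 a ≤ 0 := by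
    have hwin : Ioo (0 : ℝ) 4⁻¹ ∈ 𝓝[>] (0 : ℝ) := Ioo_mem_nhdsGT (by norm_num)
    filter_upwards [hwin] with a ha
    rw [slope_def_field]
    have hnorm : ‖(pt2 a 0 : 𝔼 2)‖ < 2⁻¹ := by
      rw [EuclideanSpace.norm_eq]
      have : ∑ i : Fin 2, ‖(pt2 a 0 : 𝔼 2) i‖ ^ 2 = a ^ 2 := by
        simp [Fin.sum_univ_two]
      rw [this, Real.sqrt_sq_eq_abs, abs_of_pos ha.1]
      linarith [ha.2]
    have hlt := b.norm_Fband_lt_two hB hcross hnorm (by simpa using ha.1)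
    have hle : ‖b.Fband (pt2 a 0)‖ ^ 2 ≤ 4 := by nlinarith [norm_nonneg (b.Fband (pt2 a 0))]
    have hp0 : ‖b.Fband (pt2 0 0)‖ ^ 2 = 4 := by rw [h0, b.norm_pZero hcross]; norm_num
    apply div_nonpos_of_nonpos_of_nonneg
    · linarith
    · linarith [ha.1]
  have ht : Tendsto (slope (fun a : ℝ ↦ ‖b.Fband (pt2 a 0)‖ ^ 2) 0) (𝓝[>] (0 : ℝ)) (𝓝 (2 * ⟪b.pZero, b.fZero⟫)) :=
    (hasDerivAt_iff_tendsto_slope.1 hd).mono_left (nhdsWithin_mono _ fun x hx ↦ ne_of_gt hx)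
  have := le_of_tendsto ht hslope
  linarith

end Differential

/-! ### The frame and the blow-up coordinates -/

/-- A vector of `ℝ³` as a function `Fin 3 → ℝ`. [folklore] -/
abbrev vec3 (v : 𝔼 3) : Fin 3 → ℝ := WithLp.ofLp v

/-- **Third frame vector**: the cross product `fZero × fOne` (normal to the band at the crossing
point, in the chart). [folklore] -/
def gTwo : 𝔼 3 := WithLp.toLp 2 (vec3 b.fZero ⨯₃ vec3 b.fOne)

/-- The frame matrix: columns `fZero`, `fOne`, `gTwo`. [folklore] -/
def frameMat : Matrix (Fin 3) (Fin 3) ℝ := (![vec3 b.fZero, vec3 b.fOne, vec3 b.gTwo] : Matrix (Fin 3) (Fin 3) ℝ)ᵀ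

/-- The frame matrix acts by `Y ↦ Y₀ fZero + Y₁ fOne + Y₂ gTwo`. [folklore] -/
theorem frameMat_mulVec (Y : Fin 3 → ℝ) :
    b.frameMat.mulVec Y = Y 0 • vec3 b.fZero + Y 1 • vec3 b.fOne + Y 2 • vec3 b.gTwo := by
  ext i
  simp [frameMat, Matrix.mulVec, dotProduct, Matrix.transpose_apply, Fin.sum_univ_three]
  ring

section Frame

variable (hcross : b.band ⁻¹' sphereEquator 2 ∩ squareNhd b.δ = {x ∈ squareNhd b.δ | x 0 = 2⁻¹})
include hcross

/-- The two frame vectors are linearly independent as functions `Fin 3 → ℝ`. [folklore] -/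
theorem linearIndependent_vec3 : LinearIndependent ℝ ![vec3 b.fZero, vec3 b.fOne] := by
  have h := (b.linearIndependent_fZero_fOne hcross).map' ((WithLp.linearEquiv 2 ℝ (Fin 3 → ℝ)) : 𝔼 3 →ₗ[ℝ] (Fin 3 → ℝ))
    (LinearEquiv.ker _)
  have e : ⇑((WithLp.linearEquiv 2 ℝ (Fin 3 → ℝ)) : 𝔼 3 →ₗ[ℝ] (Fin 3 → ℝ)) ∘ ![b.fZero, b.fOne] =
      ![vec3 b.fZero, vec3 b.fOne] := by
    funext i; fin_cases i <;> rfl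
  rwa [e] at h

/-- The cross product of the frame vectors is nonzero. [folklore] -/
theorem cross_ne_zero : vec3 b.fZero ⨯₃ vec3 b.fOne ≠ 0 :=
  crossProduct_ne_zero_iff_linearIndependent.2 (b.linearIndependent_vec3 hcross)

/-- The third frame vector is nonzero. [folklore] -/
theorem gTwo_ne_zero : b.gTwo ≠ 0 := by
  intro h
  apply b.cross_ne_zero hcross
  have := congrArg vec3 h
  simpa [gTwo] using this

/-- **The frame matrix has positive determinant** `‖fZero × fOne‖²`. [folklore] -/
theorem det_frameMat_pos : 0 < b.frameMat.det := by
  rw [frameMat, Matrix.det_transpose, ← triple_product_eq_det, triple_product_permutation,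
    triple_product_permutation]
  have hg : vec3 b.gTwo = vec3 b.fZero ⨯₃ vec3 b.fOne := rfl
  rw [← hg]
  have hne : vec3 b.gTwo ≠ 0 := hg ▸ b.cross_ne_zero hcross
  have hnn : 0 ≤ vec3 b.gTwo ⬝ᵥ vec3 b.gTwo := Finset.sum_nonneg fun i _ ↦ mul_self_nonneg _
  rcases hnn.eq_or_lt with h | h
  · exact absurd (dotProduct_self_eq_zero.1 h.symm) hne
  · exact h

/-- The determinant of the frame matrix is a unit. [folklore] -/
theorem isUnit_det_frameMat : IsUnit b.frameMat.det :=
  isUnit_iff_ne_zero.2 (b.det_frameMat_pos hcross).ne'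

/-- **The crossing frame** `ℝ³ ≃L[ℝ] ℝ³`, `Y ↦ Y₀ fZero + Y₁ fOne + Y₂ gTwo`. [folklore] -/
def frame : (𝔼 3) ≃L[ℝ] 𝔼 3 :=
  (((WithLp.linearEquiv 2 ℝ (Fin 3 → ℝ)).trans
    ((Matrix.toLinearEquiv' b.frameMat (Matrix.invertibleOfIsUnitDet _ (b.isUnit_det_frameMat hcross))).trans
      (WithLp.linearEquiv 2 ℝ (Fin 3 → ℝ)).symm))).toContinuousLinearEquiv

/-- The frame as a function. [folklore] -/
theorem frame_apply (Y : 𝔼 3) : b.frame hcross Y = Y 0 • b.fZero + Y 1 • b.fOne + Y 2 • b.gTwo := by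
  apply (WithLp.linearEquiv 2 ℝ (Fin 3 → ℝ)).injective
  simp only [frame, LinearEquiv.coe_toContinuousLinearEquiv', LinearEquiv.trans_apply,
    LinearEquiv.apply_symm_apply, map_add, map_smul]
  change Matrix.toLin' b.frameMat (vec3 Y) = _
  rw [Matrix.toLin'_apply, frameMat_mulVec]
  rfl

/-- The frame on the first two coordinate directions. [folklore] -/
theorem frame_inl (a v : ℝ) : b.frame hcross (WithLp.toLp 2 ![a, v, 0]) = a • b.fZero + v • b.fOne := by
  rw [frame_apply]; simp

/-- **The differential of `Fband` at `0` in the frame**: `D Fband (0) q = frame (q₀, q₁, 0)`.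
[folklore] -/
theorem fderiv_Fband_zero_apply (q : 𝔼 2) :
    fderiv ℝ b.Fband 0 q = b.frame hcross (WithLp.toLp 2 ![q 0, q 1, 0]) := by
  rw [frame_inl]
  have e : q = q 0 • pt2 1 0 + q 1 • pt2 0 1 := by
    ext i; fin_cases i <;> simp
  conv_lhs => rw [e]
  simp only [map_add, map_smul]
  rfl

/-- **The blow-up coordinates** at scale `κ`: `blowUp κ y = κ⁻¹ frame⁻¹ (y - pZero)`. [folklore] -/
def blowUp (κ : ℝ) (y : 𝔼 3) : 𝔼 3 := κ⁻¹ • (b.frame hcross).symm (y - b.pZero)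

/-- The inverse of the blow-up coordinates: `pZero + κ frame Y`. [folklore] -/
def blowDown (κ : ℝ) (Y : 𝔼 3) : 𝔼 3 := b.pZero + κ • b.frame hcross Y

/-- `blowUp ∘ blowDown = id` for `κ ≠ 0`. [folklore] -/
theorem blowUp_blowDown {κ : ℝ} (hκ : κ ≠ 0) (Y : 𝔼 3) : b.blowUp hcross κ (b.blowDown hcross κ Y) = Y := by
  simp [blowUp, blowDown, map_smul, smul_smul, inv_mul_cancel₀ hκ]

/-- `blowDown ∘ blowUp = id` for `κ ≠ 0`. [folklore] -/
theorem blowDown_blowUp {κ : ℝ} (hκ : κ ≠ 0) (y : 𝔼 3) : b.blowDown hcross κ (b.blowUp hcross κ y) = y := by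
  simp [blowUp, blowDown, map_smul, smul_smul, mul_inv_cancel₀ hκ]

/-- The blow-down map is affine: differences scale by `κ frame`. [folklore] -/
theorem blowDown_sub (κ : ℝ) (Y Y' : 𝔼 3) :
    b.blowDown hcross κ Y - b.blowDown hcross κ Y' = κ • b.frame hcross (Y - Y') := by
  simp [blowDown, map_sub, smul_sub]

/-- The blow-down map is continuous (indeed affine). [folklore] -/
theorem continuous_blowDown (κ : ℝ) : Continuous (b.blowDown hcross κ) :=
  continuous_const.add ((b.frame hcross).continuous.const_smul κ)

/-- The blow-down map is `C^∞`. [folklore] -/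
theorem contDiff_blowDown (κ : ℝ) : ContDiff ℝ ∞ (b.blowDown hcross κ) :=
  contDiff_const.add ((b.frame hcross).contDiff.const_smul κ)

/-! ### Flatness at the crossing point -/

/-- **Flatness of the band at the crossing point, in the frame**: for every `ε > 0` there is
`r > 0` (below the pole-free radius) such that for `‖q‖, ‖q'‖ < r`,
`‖frame⁻¹ (Fband q - Fband q') - (q₀ - q'₀, q₁ - q'₁, 0)‖ ≤ ε ‖q - q'‖` (strict differentiability
of `Fband` at `0`). [folklore] -/
theorem exists_flat {ε : ℝ} (hε : 0 < ε) : ∃ r > 0, r ≤ b.poleRad hcross ∧ ∀ q q' : 𝔼 2, ‖q‖ < r → ‖q'‖ < r →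
    ‖(b.frame hcross).symm (b.Fband q - b.Fband q') - WithLp.toLp 2 ![q 0 - q' 0, q 1 - q' 1, 0]‖ ≤ ε * ‖q - q'‖ := by
  have hstrict : HasStrictFDerivAt b.Fband (fderiv ℝ b.Fband 0) 0 :=
    (b.contDiffAt_Fband_zero hcross).hasStrictFDerivAt (by simp)
  set C := ‖((b.frame hcross).symm : (𝔼 3) →L[ℝ] 𝔼 3)‖ with hC
  have hC0 : 0 ≤ C := norm_nonneg _
  have hε' : 0 < ε / (C + 1) := div_pos hε (by linarith)
  have hlo := (hasStrictFDerivAt_iff_isLittleO.1 hstrict).def hε'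
  obtain ⟨r₀, hr₀, hball⟩ := Metric.eventually_nhds_iff.1 hlo
  refine ⟨min (r₀ / 2) (b.poleRad hcross), lt_min (by linarith) (b.poleRad_pos hcross).1, min_le_right _ _,
    fun q q' hq hq' ↦ ?_⟩
  have hq0 : ‖q‖ < r₀ / 2 := lt_of_lt_of_le hq (min_le_left _ _)
  have hq0' : ‖q'‖ < r₀ / 2 := lt_of_lt_of_le hq' (min_le_left _ _)
  have hdist : dist (q, q') (0, 0) < r₀ := by
    rw [Prod.dist_eq, dist_zero_right, dist_zero_right]
    exact max_lt (by linarith) (by linarith)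
  have key := hball hdist
  simp only at key
  -- transport by `frame⁻¹`
  have hlin : (b.frame hcross).symm (fderiv ℝ b.Fband 0 (q - q')) = WithLp.toLp 2 ![q 0 - q' 0, q 1 - q' 1, 0] := by
    rw [b.fderiv_Fband_zero_apply hcross, ContinuousLinearEquiv.symm_apply_apply]
    simp
  have e : (b.frame hcross).symm (b.Fband q - b.Fband q') - WithLp.toLp 2 ![q 0 - q' 0, q 1 - q' 1, 0] =
      (b.frame hcross).symm (b.Fband q - b.Fband q' - fderiv ℝ b.Fband 0 (q - q')) := by
    rw [map_sub ((b.frame hcross).symm) (b.Fband q - b.Fband q'), hlin]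
  rw [e]
  calc ‖(b.frame hcross).symm (b.Fband q - b.Fband q' - fderiv ℝ b.Fband 0 (q - q'))‖
      ≤ C * ‖b.Fband q - b.Fband q' - fderiv ℝ b.Fband 0 (q - q')‖ := ((b.frame hcross).symm : (𝔼 3) →L[ℝ] 𝔼 3).le_opNorm _
    _ ≤ C * (ε / (C + 1) * ‖q - q'‖) := by gcongr
    _ ≤ ε * ‖q - q'‖ := by
        have h1 : C * (ε / (C + 1)) ≤ ε := by
          rw [mul_div_assoc']
          exact (div_le_iff₀ (by linarith)).2 (by nlinarith)
        nlinarith [norm_nonneg (q - q')]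

/-- **Flatness of the differential**: for every `ε > 0` there is `r > 0` such that for `‖q‖ < r`
and every `w`, `‖frame⁻¹ (D Fband (q) w) - (w₀, w₁, 0)‖ ≤ ε ‖w‖` (continuity of the differential
at `0`). [folklore] -/
theorem exists_flat_fderiv {ε : ℝ} (hε : 0 < ε) : ∃ r > 0, r ≤ b.poleRad hcross ∧ ∀ q : 𝔼 2, ‖q‖ < r → ∀ w : 𝔼 2,
    ‖(b.frame hcross).symm (fderiv ℝ b.Fband q w) - WithLp.toLp 2 ![w 0, w 1, 0]‖ ≤ ε * ‖w‖ := by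
  have hcont : ContinuousAt (fderiv ℝ b.Fband) 0 := (b.contDiffAt_Fband_zero hcross).continuousAt_fderiv (by simp)
  set C := ‖((b.frame hcross).symm : (𝔼 3) →L[ℝ] 𝔼 3)‖ with hC
  have hC0 : 0 ≤ C := norm_nonneg _
  have hε' : 0 < ε / (C + 1) := div_pos hε (by linarith)
  obtain ⟨r₀, hr₀, hball⟩ := Metric.continuousAt_iff.1 hcont _ hε'
  refine ⟨min r₀ (b.poleRad hcross), lt_min hr₀ (b.poleRad_pos hcross).1, min_le_right _ _, fun q hq w ↦ ?_⟩
  have hq0 : dist q 0 < r₀ := by rw [dist_zero_right]; exact lt_of_lt_of_le hq (min_le_left _ _)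
  have key : ‖fderiv ℝ b.Fband q - fderiv ℝ b.Fband 0‖ < ε / (C + 1) := by
    have := hball hq0; rwa [dist_eq_norm] at this
  have hlin : (b.frame hcross).symm (fderiv ℝ b.Fband 0 w) = WithLp.toLp 2 ![w 0, w 1, 0] := by
    rw [b.fderiv_Fband_zero_apply hcross, ContinuousLinearEquiv.symm_apply_apply]
  have e : (b.frame hcross).symm (fderiv ℝ b.Fband q w) - WithLp.toLp 2 ![w 0, w 1, 0] =
      (b.frame hcross).symm ((fderiv ℝ b.Fband q - fderiv ℝ b.Fband 0) w) := by
    rw [show (fderiv ℝ b.Fband q - fderiv ℝ b.Fband 0) w = fderiv ℝ b.Fband q w - fderiv ℝ b.Fband 0 w from rfl,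
      map_sub, hlin]
  rw [e]
  calc ‖(b.frame hcross).symm ((fderiv ℝ b.Fband q - fderiv ℝ b.Fband 0) w)‖
      ≤ C * ‖(fderiv ℝ b.Fband q - fderiv ℝ b.Fband 0) w‖ := ((b.frame hcross).symm : (𝔼 3) →L[ℝ] 𝔼 3).le_opNorm _
    _ ≤ C * (ε / (C + 1) * ‖w‖) := by
        gcongr
        exact (ContinuousLinearMap.le_opNorm _ _).trans (by gcongr)
    _ ≤ ε * ‖w‖ := by
        have h1 : C * (ε / (C + 1)) ≤ ε := by
          rw [mul_div_assoc']
          exact (div_le_iff₀ (by linarith)).2 (by nlinarith)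
        nlinarith [norm_nonneg w]

end Frame

end BandData

end Literature.Topology.FourManifolds
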